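import Literature.MathematicalPhysics.QuantumFieldTheory.OSContinuationPieces
import HarnessLib

/-!
# One continuation step of OS II: explicit bounds for the piece functions (Ch. VI.2, (6.22))

Topic `Literature/MathematicalPhysics/QuantumFieldTheory`; support file (all proved; one
`Prop`-valued structure and two explicit constants as definitions; no named facts) for the
discharge of (A1) `OS1975_exists_timeContinuation`. Osterwalder–Schrader II (Comm. Math. Phys. 42
(1975)), Ch. VI.2, (6.22): *"the Schwarz inequality
`|S_k(ζ̄', z, ζ)| ≤ ‖Ψₙ(x', ζ')‖ ‖Ψₘ(x, ζ)‖ …` is an immediate consequence of (P_N), Eq. (5.17)"* —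
here for the piece functions `F` of `OSContinuationPieces` and the growth class
"`|S k Z| ≤ C (∏ᵢ (|Zᵢ| + |Zᵢ|⁻¹))^p` on the argument region of every compact part of the base":

* `IsOSGrowth N S Cfun pfun` — the growth hypothesis at level `N`, with a constant `Cfun k K` for
  every compact `K ⊆ c_k^{(N+1)}` and one exponent `pfun k` per `k`;
* `norm_pieceFun_le` — for a compact part `Kp` of the piece `osPiece (N+1) k p` whose free argument
  is `≤ θ₀ < π/2`: `‖F Z‖ ≤ pieceConst · (∏ᵢ (|Zᵢ| + |Zᵢ|⁻¹))^{pieceExp}` on the argument region of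
  `Kp`, where `pieceConst`, `pieceExp` are **explicit** in `(CT, Cfun, pfun, k, p, Kp, cos θ₀)` —
  through the Schwarz inequality with the split `x' = x = Re Z_p/4`, `τ = Z_p - Re Z_p/2`, the norm
  identity `‖Ψ m x ζ‖² = Re S_{2m+1}(θζ, 2x, ζ)` and the level-`N` growth at the compact sets
  `dEmbed '' (splitLeft '' Kp)`, `dEmbed '' (splitRight '' Kp)`.

## References

* K. Osterwalder, R. Schrader, *Axioms for Euclidean Green's functions II*, Comm. Math. Phys. 42
  (1975) 281–305, Ch. VI.2 (6.22)–(6.23). [OsterwalderSchraderCMP1975]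
-/

noncomputable section

open Metric Set Filter Complex
open scoped Topology ComplexConjugate InnerProductSpace

namespace Literature.MathematicalPhysics.QuantumFieldTheory.OSEnvelope

open Literature.Analysis.Complex Literature.MathematicalPhysics.QuantumFieldTheory

variable {H : Type*} [NormedAddCommGroup H] [InnerProductSpace ℂ H]

/-! ### The growth class -/

/-- The growth factor `Π(Z) = ∏ᵢ (‖Zᵢ‖ + ‖Zᵢ‖⁻¹)`. [folklore] -/
def gFactor {k : ℕ} (Z : Fin k → ℂ) : ℝ := ∏ i, (‖Z i‖ + ‖Z i‖⁻¹)

/-- `1 ≤ r + r⁻¹` for `r > 0`. [folklore] -/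
theorem one_le_add_inv {r : ℝ} (hr : 0 < r) : 1 ≤ r + r⁻¹ := by
  rcases le_or_gt 1 r with h | h
  · linarith [inv_pos.2 hr]
  · have : 1 < r⁻¹ := (one_lt_inv₀ hr).2 h
    linarith

/-- Each factor of `Π(Z)` is `≥ 1` (nonzero entries). [folklore] -/
theorem one_le_normFactor {z : ℂ} (hz : z ≠ 0) : 1 ≤ ‖z‖ + ‖z‖⁻¹ :=
  one_le_add_inv (norm_pos_iff.2 hz)

/-- `Π(Z) ≥ 1` for nonzero entries. [folklore] -/
theorem one_le_gFactor {k : ℕ} {Z : Fin k → ℂ} (hZ : ∀ i, Z i ≠ 0) : 1 ≤ gFactor Z :=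
  Finset.one_le_prod fun i _ => one_le_normFactor (hZ i)

/-- `Π(Z) ≥ 0`. [folklore] -/
theorem gFactor_nonneg {k : ℕ} (Z : Fin k → ℂ) : 0 ≤ gFactor Z :=
  Finset.prod_nonneg fun i _ => by positivity

/-- A single factor is bounded by `Π(Z)` (nonzero entries). [folklore] -/
theorem normFactor_le_gFactor {k : ℕ} {Z : Fin k → ℂ} (hZ : ∀ i, Z i ≠ 0) (j : Fin k) :
    ‖Z j‖ + ‖Z j‖⁻¹ ≤ gFactor Z := by
  unfold gFactor
  have h := Finset.prod_le_prod_of_subset_of_one_le (f := fun i => ‖Z i‖ + ‖Z i‖⁻¹)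
    (Finset.singleton_subset_iff.2 (Finset.mem_univ j)) (fun i _ => by positivity)
    (fun i _ _ => one_le_normFactor (hZ i))
  rwa [Finset.prod_singleton] at h

/-- Raising the exponent of `Π(Z) ≥ 1`. [folklore] -/
theorem gFactor_pow_le_pow {k : ℕ} {Z : Fin k → ℂ} (hZ : ∀ i, Z i ≠ 0) {a b : ℕ} (hab : a ≤ b) :
    gFactor Z ^ a ≤ gFactor Z ^ b :=
  pow_le_pow_right₀ (one_le_gFactor hZ) hab

/-- **Level-`N` growth**: for every `k` and compact `K ⊆ c_k^{(N+1)}`, on the argument region of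
`K`, `‖S k Z‖ ≤ Cfun k K · Π(Z)^{pfun k}` (the temperedness class of OS II (4.5)/(6.20) in the
variables `ζ`, transported along the induction). [cite: OsterwalderSchraderCMP1975, Ch. VI.2 (6.20), (6.28)] -/
structure IsOSGrowth (N : ℕ) (S : (k : ℕ) → (Fin k → ℂ) → ℂ) (Cfun : (k : ℕ) → Set (Fin k → ℝ) → ℝ)
    (pfun : ℕ → ℕ) : Prop where
  bound : ∀ (k : ℕ) (K : Set (Fin k → ℝ)), K ⊆ osBaseC (N + 1) k → IsCompact K →
    ∀ Z ∈ argRegion K, ‖S k Z‖ ≤ Cfun k K * gFactor Z ^ pfun k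

/-! ### The Gram points of the vectors -/

/-- The argument vector of `(θw, t, w)` for `t > 0` is `dEmbed` of the argument vector of `w`. [folklore] -/
theorem arg_cDiagEmbed_star {m : ℕ} {w : Fin m → ℂ} (hw : ∀ i, 0 < (w i).re) {t : ℝ} (ht : 0 < t) :
    (fun i => (cDiagEmbed (star w) (t : ℂ) w i).arg) = dEmbed fun i => (w i).arg := by
  rw [cDiagEmbed_eq_cPlace, cPlace_map Complex.arg, dEmbed_eq_cPlace]
  congr 1
  · funext i
    simp only [Pi.star_apply, Complex.star_def]
    exact arg_conj_of_re_pos (hw i)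
  · exact Complex.arg_ofReal_of_nonneg ht.le

/-- **The Gram point `(θw, 2x, w)` lies in the argument region of `dEmbed '' K₁`** when the
arguments of `w` lie in `K₁` (and `Re wᵢ > 0`, `x > 0`). [folklore] -/
theorem cDiagEmbed_star_mem_argRegion {m : ℕ} {K₁ : Set (Fin m → ℝ)} {w : Fin m → ℂ}
    (hw : ∀ i, 0 < (w i).re) (hK : (fun i => (w i).arg) ∈ K₁) {t : ℝ} (ht : 0 < t) :
    cDiagEmbed (star w) (t : ℂ) w ∈ argRegion (dEmbed '' K₁) := by
  refine ⟨re_cDiagEmbed_pos (fun i => by simpa using hw i) (by simpa using ht) hw, ?_⟩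
  rw [arg_cDiagEmbed_star hw ht]
  exact mem_image_of_mem _ hK

/-- Each factor of `Π` at the Gram point is bounded by `(1 + 2/c₀) Π(Z)` when the free entry
`ζ` of `Z` has `Re ζ ≥ ‖ζ‖ c₀` and `t = Re ζ / 2`. [folklore] -/
theorem normFactor_cDiagEmbed_le {k m : ℕ} {Z : Fin k → ℂ} (hZ : ∀ i, Z i ≠ 0) {w : Fin m → ℂ}
    (hwZ : ∀ j, ∃ i, ‖w j‖ = ‖Z i‖) {ζ : ℂ} (hζZ : ∃ i, ζ = Z i) {c₀ : ℝ} (hc₀ : 0 < c₀)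
    (hre : ‖ζ‖ * c₀ ≤ ζ.re) (hζre : 0 < ζ.re) (i : Fin (m + 1 + m)) :
    ‖cDiagEmbed (star w) (((ζ.re / 2 : ℝ)) : ℂ) w i‖ + ‖cDiagEmbed (star w) (((ζ.re / 2 : ℝ)) : ℂ) w i‖⁻¹ ≤
      (1 + 2 / c₀) * gFactor Z := by
  have hA : 1 ≤ 1 + 2 / c₀ := by
    have : 0 ≤ 2 / c₀ := by positivity
    linarith
  have hP0 : 0 ≤ gFactor Z := gFactor_nonneg Z
  have hwfac : ∀ j, ‖w j‖ + ‖w j‖⁻¹ ≤ (1 + 2 / c₀) * gFactor Z := fun j => by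
    obtain ⟨i, hi⟩ := hwZ j
    rw [hi]
    exact (normFactor_le_gFactor hZ i).trans (le_mul_of_one_le_left hP0 hA)
  rcases lt_trichotomy (i : ℕ) m with h | h | h
  · rw [cDiagEmbed_apply_lt _ _ _ h]
    simp only [Pi.star_apply, Complex.star_def, Complex.norm_conj]
    exact hwfac _
  · rw [cDiagEmbed_apply_mid _ _ _ h]
    obtain ⟨i₀, rfl⟩ := hζZ
    have hn : 0 < ‖Z i₀‖ := norm_pos_iff.2 (hZ i₀)
    have ht : ‖(((Z i₀).re / 2 : ℝ) : ℂ)‖ = (Z i₀).re / 2 := by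
      rw [Complex.norm_real, Real.norm_eq_abs, abs_of_pos (by positivity)]
    rw [ht]
    have h1 : (Z i₀).re / 2 ≤ ‖Z i₀‖ + ‖Z i₀‖⁻¹ := by
      have := Complex.re_le_norm (Z i₀)
      have := inv_pos.2 hn
      linarith
    have h2 : ((Z i₀).re / 2)⁻¹ ≤ 2 / c₀ * (‖Z i₀‖ + ‖Z i₀‖⁻¹) := by
      rw [inv_div]
      have hden : 0 < ‖Z i₀‖ * c₀ := by positivity
      calc 2 / (Z i₀).re ≤ 2 / (‖Z i₀‖ * c₀) := div_le_div_of_nonneg_left (by norm_num) hden hre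
        _ = 2 / c₀ * ‖Z i₀‖⁻¹ := by field_simp
        _ ≤ 2 / c₀ * (‖Z i₀‖ + ‖Z i₀‖⁻¹) := by
            refine mul_le_mul_of_nonneg_left ?_ (by positivity)
            linarith [norm_nonneg (Z i₀)]
    calc (Z i₀).re / 2 + ((Z i₀).re / 2)⁻¹ ≤ (1 + 2 / c₀) * (‖Z i₀‖ + ‖Z i₀‖⁻¹) := by
          rw [add_mul, one_mul]; exact add_le_add h1 h2
      _ ≤ (1 + 2 / c₀) * gFactor Z :=
          mul_le_mul_of_nonneg_left (normFactor_le_gFactor hZ i₀) (by positivity)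
  · rw [cDiagEmbed_apply_gt _ _ _ h]
    exact hwfac _

/-- **`Π` at the Gram point**: `Π(θw, Re ζ/2, w) ≤ ((1 + 2/c₀) Π(Z))^{2m+1}`. [folklore] -/
theorem gFactor_cDiagEmbed_le {k m : ℕ} {Z : Fin k → ℂ} (hZ : ∀ i, Z i ≠ 0) {w : Fin m → ℂ}
    (hwZ : ∀ j, ∃ i, ‖w j‖ = ‖Z i‖) {ζ : ℂ} (hζZ : ∃ i, ζ = Z i) {c₀ : ℝ} (hc₀ : 0 < c₀)
    (hre : ‖ζ‖ * c₀ ≤ ζ.re) (hζre : 0 < ζ.re) :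
    gFactor (cDiagEmbed (star w) (((ζ.re / 2 : ℝ)) : ℂ) w) ≤ ((1 + 2 / c₀) * gFactor Z) ^ (m + 1 + m) := by
  unfold gFactor
  calc (∏ i, (‖cDiagEmbed (star w) (((ζ.re / 2 : ℝ)) : ℂ) w i‖ +
        ‖cDiagEmbed (star w) (((ζ.re / 2 : ℝ)) : ℂ) w i‖⁻¹))
      ≤ ∏ _i : Fin (m + 1 + m), (1 + 2 / c₀) * gFactor Z :=
        Finset.prod_le_prod (fun i _ => by positivity)
          fun i _ => normFactor_cDiagEmbed_le hZ hwZ hζZ hc₀ hre hζre i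
    _ = ((1 + 2 / c₀) * gFactor Z) ^ (m + 1 + m) := by
        rw [Finset.prod_const, Finset.card_univ, Fintype.card_fin]

/-! ### The explicit constants -/

/-- The compact set of level-`N` Gram arguments attached to the left blocks of `Kp`. [folklore] -/
def leftGramSet {k : ℕ} (p : Fin k) (Kp : Set (Fin k → ℝ)) : Set (Fin (p + 1 + p) → ℝ) :=
  dEmbed '' ((fun v => splitLeft v p) '' Kp)

/-- The compact set of level-`N` Gram arguments attached to the right blocks of `Kp`. [folklore] -/
def rightGramSet {k : ℕ} (p : Fin k) (Kp : Set (Fin k → ℝ)) : Set (Fin (k - 1 - p + 1 + (k - 1 - p)) → ℝ) :=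
  dEmbed '' ((fun v => splitRight v p) '' Kp)

/-- **The exponent of the piece bound.** [folklore] -/
def pieceExp (pfun : ℕ → ℕ) (k : ℕ) (p : Fin k) : ℕ :=
  max ((p + 1 + p) * pfun (p + 1 + p)) ((k - 1 - p + 1 + (k - 1 - p)) * pfun (k - 1 - p + 1 + (k - 1 - p)))

/-- **The constant of the piece bound.** [folklore] -/
def pieceConst (CT : ℝ) (Cfun : (k : ℕ) → Set (Fin k → ℝ) → ℝ) (pfun : ℕ → ℕ) (k : ℕ) (p : Fin k)
    (Kp : Set (Fin k → ℝ)) (c₀ : ℝ) : ℝ :=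
  max CT 0 / 2 *
    (max (Cfun (p + 1 + p) (leftGramSet p Kp)) 0 * (1 + 2 / c₀) ^ ((p + 1 + p) * pfun (p + 1 + p)) +
      max (Cfun (k - 1 - p + 1 + (k - 1 - p)) (rightGramSet p Kp)) 0 *
        (1 + 2 / c₀) ^ ((k - 1 - p + 1 + (k - 1 - p)) * pfun (k - 1 - p + 1 + (k - 1 - p))))

/-- The Gram sets are compact subsets of the bases when `Kp` is a compact part of the piece. [folklore] -/
theorem leftGramSet_props {N k : ℕ} (p : Fin k) {Kp : Set (Fin k → ℝ)} (hKc : IsCompact Kp)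
    (hKp : Kp ⊆ osPiece (N + 1) k p) :
    IsCompact (leftGramSet p Kp) ∧ leftGramSet p Kp ⊆ osBaseC (N + 1) (p + 1 + p) := by
  refine ⟨(hKc.image (continuous_splitLeft p)).image (continuous_dEmbed _), ?_⟩
  rintro _ ⟨u, ⟨v, hv, rfl⟩, rfl⟩
  exact (mem_osBaseD_iff _).1 (hKp hv).1

/-- The Gram sets are compact subsets of the bases when `Kp` is a compact part of the piece. [folklore] -/
theorem rightGramSet_props {N k : ℕ} (p : Fin k) {Kp : Set (Fin k → ℝ)} (hKc : IsCompact Kp)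
    (hKp : Kp ⊆ osPiece (N + 1) k p) :
    IsCompact (rightGramSet p Kp) ∧ rightGramSet p Kp ⊆ osBaseC (N + 1) (k - 1 - p + 1 + (k - 1 - p)) := by
  refine ⟨(hKc.image (continuous_splitRight p)).image (continuous_dEmbed _), ?_⟩
  rintro _ ⟨u, ⟨v, hv, rfl⟩, rfl⟩
  exact (mem_osBaseD_iff _).1 (hKp hv).2.2

/-! ### The bound -/

section Bound

variable {T : ℂ → H →L[ℂ] H} {CT : ℝ} {N : ℕ} {S : (k : ℕ) → (Fin k → ℂ) → ℂ}
  {Cfun : (k : ℕ) → Set (Fin k → ℝ) → ℝ} {pfun : ℕ → ℕ}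

omit [InnerProductSpace ℂ H] in
/-- **Norms of the vectors through the level-`N` growth**: for `ζ` in the argument region of
`d_m^{(N+1)}` with arguments in `K₁`, `‖Ψ m x ζ‖² ≤ Cfun (2m+1) (dEmbed '' K₁) · Π(θζ, 2x, ζ)^{p}`. [cite: OsterwalderSchraderCMP1975, Ch. VI.2 (6.22)] -/
theorem norm_vec_sq_le (hG : IsOSGrowth N S Cfun pfun) {Ψ : (m : ℕ) → ℝ → (Fin m → ℂ) → H}
    (hnorm : ∀ (m : ℕ) (x : ℝ), 0 < x → ∀ ζ ∈ argRegion (osBaseD (N + 1) m),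
      ‖Ψ m x ζ‖ ^ 2 = (S (m + 1 + m) (cDiagEmbed (star ζ) ((2 * x : ℝ) : ℂ) ζ)).re)
    {m : ℕ} {K₁ : Set (Fin m → ℝ)} (hK₁ : K₁ ⊆ osBaseD (N + 1) m) (hK₁c : IsCompact K₁)
    {x : ℝ} (hx : 0 < x) {w : Fin m → ℂ} (hw : ∀ i, 0 < (w i).re) (hwK : (fun i => (w i).arg) ∈ K₁) :
    ‖Ψ m x w‖ ^ 2 ≤ max (Cfun (m + 1 + m) (dEmbed '' K₁)) 0 *
      gFactor (cDiagEmbed (star w) ((2 * x : ℝ) : ℂ) w) ^ pfun (m + 1 + m) := by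
  have hmem : w ∈ argRegion (osBaseD (N + 1) m) := ⟨hw, hK₁ hwK⟩
  rw [hnorm m x hx w hmem]
  have hK : dEmbed '' K₁ ⊆ osBaseC (N + 1) (m + 1 + m) := by
    rintro _ ⟨u, hu, rfl⟩; exact (mem_osBaseD_iff _).1 (hK₁ hu)
  have hKc : IsCompact (dEmbed '' K₁) := hK₁c.image (continuous_dEmbed _)
  have hP := cDiagEmbed_star_mem_argRegion hw hwK (by positivity : 0 < 2 * x)
  have h := hG.bound (m + 1 + m) _ hK hKc _ hP
  exact (Complex.re_le_norm _).trans (h.trans (mul_le_mul_of_nonneg_right (le_max_left _ _)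
    (pow_nonneg (gFactor_nonneg _) _)))

/-- **The explicit bound for the piece functions** (OS II (6.22)–(6.23) in this setting): on the
argument region of a compact part `Kp` of the piece at position `p` with free argument
`≤ θ₀ < π/2`, `‖F Z‖ ≤ pieceConst · Π(Z)^{pieceExp}`. [cite: OsterwalderSchraderCMP1975, Ch. VI.2 (6.22)–(6.23)] -/
theorem norm_pieceFun_le (hT : IsOSSemigroup T CT) (hG : IsOSGrowth N S Cfun pfun)
    {Ψ : (m : ℕ) → ℝ → (Fin m → ℂ) → H}
    (hnorm : ∀ (m : ℕ) (x : ℝ), 0 < x → ∀ ζ ∈ argRegion (osBaseD (N + 1) m),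
      ‖Ψ m x ζ‖ ^ 2 = (S (m + 1 + m) (cDiagEmbed (star ζ) ((2 * x : ℝ) : ℂ) ζ)).re)
    {k : ℕ} {p : Fin k} {F : (Fin k → ℂ) → ℂ}
    (hF : ∀ Z ∈ argRegion (osPiece (N + 1) k p), ∀ (x' x : ℝ) (τ : ℂ), 0 < x' → 0 < x → 0 ≤ τ.re →
      (x' : ℂ) + x + τ = Z p →
        F Z = ⟪Ψ p x' (star (blockRevLeft Z p)), T τ (Ψ (k - 1 - p) x (blockRight Z p))⟫_ℂ)
    {Kp : Set (Fin k → ℝ)} (hKc : IsCompact Kp) (hKp : Kp ⊆ osPiece (N + 1) k p)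
    {θ₀ : ℝ} (hθ₀ : θ₀ < Real.pi / 2) (hθKp : ∀ v ∈ Kp, |v p| ≤ θ₀)
    {Z : Fin k → ℂ} (hZ : Z ∈ argRegion Kp) :
    ‖F Z‖ ≤ pieceConst CT Cfun pfun k p Kp (Real.cos θ₀) * gFactor Z ^ pieceExp pfun k p := by
  -- the free entry
  set ζ : ℂ := Z p with hζ
  have hZne : ∀ i, Z i ≠ 0 := fun i h => by have := hZ.1 i; rw [h] at this; simp at this
  have hζre : 0 < ζ.re := hZ.1 p
  have hc₀ : 0 < Real.cos θ₀ := by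
    have hθ0 : 0 ≤ θ₀ := by
      rcases Kp.eq_empty_or_nonempty with h | ⟨v, hv⟩
      · exact absurd hZ.2 (by rw [h]; exact notMem_empty _)
      · exact (abs_nonneg _).trans (hθKp v hv)
    exact Real.cos_pos_of_mem_Ioo ⟨by linarith [Real.pi_pos], hθ₀⟩
  have hre : ‖ζ‖ * Real.cos θ₀ ≤ ζ.re :=
    norm_mul_cos_le_re_of_abs_arg_le hθ₀.le (hθKp _ hZ.2)
  -- the split
  set x : ℝ := ζ.re / 4 with hx
  have hx0 : 0 < x := by positivity
  set τ : ℂ := ζ - ((ζ.re / 2 : ℝ) : ℂ) with hτ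
  have hτre : 0 < τ.re := by simp only [hτ, Complex.sub_re, Complex.ofReal_re]; linarith
  have hsum : (x : ℂ) + x + τ = ζ := by simp only [hx, hτ]; push_cast; ring
  have hZpiece : Z ∈ argRegion (osPiece (N + 1) k p) := ⟨hZ.1, hKp hZ.2⟩
  rw [hF Z hZpiece x x τ hx0 hx0 hτre.le hsum]
  -- Schwarz
  set w : Fin p → ℂ := star (blockRevLeft Z p) with hw
  set z : Fin (k - 1 - p) → ℂ := blockRight Z p with hz
  have hw_re : ∀ i, 0 < (w i).re := re_star_blockRevLeft_pos hZ.1 p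
  have hz_re : ∀ j, 0 < (z j).re := re_blockRight_pos hZ.1 p
  have hwK : (fun i => (w i).arg) ∈ (fun v => splitLeft v p) '' Kp := by
    rw [hw, arg_star_blockRevLeft hZ.1 p]; exact mem_image_of_mem _ hZ.2
  have hzK : (fun j => (z j).arg) ∈ (fun v => splitRight v p) '' Kp := by
    rw [hz, arg_blockRight]; exact mem_image_of_mem _ hZ.2
  have hK₁ : (fun v => splitLeft v p) '' Kp ⊆ osBaseD (N + 1) p := by
    rintro _ ⟨v, hv, rfl⟩; exact (hKp hv).1
  have hK₂ : (fun v => splitRight v p) '' Kp ⊆ osBaseD (N + 1) (k - 1 - p) := by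
    rintro _ ⟨v, hv, rfl⟩; exact (hKp hv).2.2
  set a : ℝ := ‖Ψ p x w‖ with ha
  set b : ℝ := ‖Ψ (k - 1 - p) x z‖ with hb
  have hSchwarz : ‖⟪Ψ p x w, T τ (Ψ (k - 1 - p) x z)⟫_ℂ‖ ≤ max CT 0 * (a * b) := by
    calc ‖⟪Ψ p x w, T τ (Ψ (k - 1 - p) x z)⟫_ℂ‖ ≤ ‖Ψ p x w‖ * ‖T τ (Ψ (k - 1 - p) x z)‖ :=
          norm_inner_le_norm _ _
      _ ≤ ‖Ψ p x w‖ * (‖T τ‖ * ‖Ψ (k - 1 - p) x z‖) :=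
          mul_le_mul_of_nonneg_left ((T τ).le_opNorm _) (norm_nonneg _)
      _ ≤ a * (max CT 0 * b) := by
          refine mul_le_mul_of_nonneg_left (mul_le_mul_of_nonneg_right
            ((hT.norm_le τ hτre).trans (le_max_left _ _)) (norm_nonneg _)) (norm_nonneg _)
      _ = max CT 0 * (a * b) := by ring
  -- the two norms through the level-`N` growth
  have h2x : 2 * x = ζ.re / 2 := by rw [hx]; ring
  have hwZ : ∀ j, ∃ i, ‖w j‖ = ‖Z i‖ := fun j =>
    ⟨⟨p - 1 - j, by have := p.2; omega⟩, by simp [hw, Pi.star_apply]⟩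
  have hzZ : ∀ j, ∃ i, ‖z j‖ = ‖Z i‖ := fun j => ⟨⟨p + 1 + j, by have := j.2; omega⟩, by simp [hz]⟩
  have hζZ : ∃ i, ζ = Z i := ⟨p, rfl⟩
  set A : ℝ := 1 + 2 / Real.cos θ₀ with hA
  have hA1 : 1 ≤ A := by
    have : 0 ≤ 2 / Real.cos θ₀ := by positivity
    rw [hA]; linarith
  set e₁ : ℕ := (p + 1 + p) * pfun (p + 1 + p) with he₁
  set e₂ : ℕ := (k - 1 - p + 1 + (k - 1 - p)) * pfun (k - 1 - p + 1 + (k - 1 - p)) with he₂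
  set C₁ : ℝ := max (Cfun (p + 1 + p) (leftGramSet p Kp)) 0 with hC₁
  set C₂ : ℝ := max (Cfun (k - 1 - p + 1 + (k - 1 - p)) (rightGramSet p Kp)) 0 with hC₂
  have ha2 : a ^ 2 ≤ C₁ * (A * gFactor Z) ^ e₁ := by
    have h := norm_vec_sq_le hG hnorm hK₁ (hKc.image (continuous_splitLeft p)) hx0 hw_re hwK
    refine h.trans ?_
    rw [he₁, pow_mul]
    refine mul_le_mul_of_nonneg_left (pow_le_pow_left₀ (gFactor_nonneg _) ?_ _) (le_max_right _ _)
    rw [h2x]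
    exact gFactor_cDiagEmbed_le hZne hwZ hζZ hc₀ hre hζre
  have hb2 : b ^ 2 ≤ C₂ * (A * gFactor Z) ^ e₂ := by
    have h := norm_vec_sq_le hG hnorm hK₂ (hKc.image (continuous_splitRight p)) hx0 hz_re hzK
    refine h.trans ?_
    rw [he₂, pow_mul]
    refine mul_le_mul_of_nonneg_left (pow_le_pow_left₀ (gFactor_nonneg _) ?_ _) (le_max_right _ _)
    rw [h2x]
    exact gFactor_cDiagEmbed_le hZne hzZ hζZ hc₀ hre hζre
  -- assemble: `ab ≤ (a² + b²)/2`, raise exponents to the max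
  have hab : a * b ≤ (a ^ 2 + b ^ 2) / 2 := by nlinarith [sq_nonneg (a - b)]
  have hpow₁ : (A * gFactor Z) ^ e₁ ≤ A ^ e₁ * gFactor Z ^ pieceExp pfun k p := by
    rw [mul_pow]
    exact mul_le_mul_of_nonneg_left (gFactor_pow_le_pow hZne (le_max_left _ _)) (by positivity)
  have hpow₂ : (A * gFactor Z) ^ e₂ ≤ A ^ e₂ * gFactor Z ^ pieceExp pfun k p := by
    rw [mul_pow]
    exact mul_le_mul_of_nonneg_left (gFactor_pow_le_pow hZne (le_max_right _ _)) (by positivity)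
  have hC₁0 : 0 ≤ C₁ := le_max_right _ _
  have hC₂0 : 0 ≤ C₂ := le_max_right _ _
  calc ‖⟪Ψ p x w, T τ (Ψ (k - 1 - p) x z)⟫_ℂ‖ ≤ max CT 0 * (a * b) := hSchwarz
    _ ≤ max CT 0 * ((a ^ 2 + b ^ 2) / 2) := mul_le_mul_of_nonneg_left hab (le_max_right _ _)
    _ ≤ max CT 0 * ((C₁ * (A ^ e₁ * gFactor Z ^ pieceExp pfun k p) +
          C₂ * (A ^ e₂ * gFactor Z ^ pieceExp pfun k p)) / 2) := by
        gcongr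
        · exact ha2.trans (mul_le_mul_of_nonneg_left hpow₁ hC₁0)
        · exact hb2.trans (mul_le_mul_of_nonneg_left hpow₂ hC₂0)
    _ = pieceConst CT Cfun pfun k p Kp (Real.cos θ₀) * gFactor Z ^ pieceExp pfun k p := by
        simp only [pieceConst, hC₁, hC₂, hA, he₁, he₂]
        ring

end Bound

end Literature.MathematicalPhysics.QuantumFieldTheory.OSEnvelope
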